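import Summits.QuantumFields.YangMills.Theorems.BalabanLadderROTSkewTorus
import HarnessLib

/-!
# Translations act on every period cell of `ℤᵈ`: invariance of Wilson's measure on a skew torus, of the cell mean and of the
# centred cell moments; the RECENTRING identities (kit for crux `CoverRecentring`, route `RecentredCoverTransfer`,
# stmt-QuantumFields-23105, LINE g9-A/B of planner ym-idea-1 g9)

Helper file (`--supports stmt-QuantumFields-23105 --as helper`; width seat `ym-line-sfw-p2-w3` g28 of cell ym-idea-1, free hands).
Route-independent (no `Theses` import), definition-free, 0 sorry, standard axioms.  It supplies the two «prover lemmas» the route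
thesis of `RecentredCoverTransfer` names as NOT DECOMPOSED: *translation invariance of `PeriodCell.measure` under cell translations
(needed for `E_{C_k} d(τ_x U) = C_k.mean`)* and *the `n = 2` identity* `dist_C(F; m_C) − dist_C(F; m_T) = −Δ²·Σ_{x,y} F(a x, a y)`.

For ANY period cell `C` of `ℤᵈ` (`Theorems.ROT.PeriodCell`) and any lattice vector `v ∈ ℤᵈ`:
* §1 the cell translation `U ↦ (e ↦ U (toRep (e.1 + v), e.2))` of skew-torus configurations intertwines the plaquette holonomies
  (`holonomy_cellTranslate`), leaves the Wilson action invariant (`action_cellTranslate`: the plaquettes are permuted), is a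
  measurable automorphism preserving the product Haar measure (`exists_measurableEquiv_cellTranslate`) and hence Wilson's measure on
  the cell (`integral_comp_cellTranslate`);
* §2 it lifts to the lattice translation `configShift (-v)` of the periodic lift (`lift_cellTranslate`), so every integral
  `∫ g(τ_v Ũ) dμ_C = ∫ g(Ũ) dμ_C` (`integral_comp_configShift_lift`); in particular ★ `integral_obs_shift_lift_eq_mean` — the
  one-point function is the constant `C.mean` — ★ `mean_comp_configShift` and ★ `moment_translate` (the centred cell moments are
  invariant under simultaneous translation of the sites);
* §3 ★ the RECENTRING identities for a bounded measurable observable `O` with cell mean `μ = C.mean O`: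
  `W_m(x) = μ − m` for `n = 1` (`moment_one_eq`), `W_m(x, y) = W_μ(x, y) + (μ − m)²` for `n = 2` (`moment_two_recentre`), and on test
  functions ★ `dist_two_recentre`: `dist_C(A; m) F = dist_C(A; μ) F + (μ − m)²·Σ_{x ∈ reps²} F(A x)` — with `m = m_T` the torus mean
  this is the `n = 2` clause of `CoverRecentring` as the scalar statement `(m_C − m_T)²·Σ F(a_k x, a_k y) → 0`.

Nothing here is specific to `d = 4`; nothing is asserted about Yang–Mills.  HONEST FRAMING: the cruxes `CoverRecentring` (23105) and
`CommonCentredCoverTransfer` (23106) stay OPEN; no item is closed; no summit, rung (R2d ROT is a RECORD rung) or mass gap is proved.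
References: K. Wilson, PRD 10 (1974) 2445; E. Seiler, LNP 159 (1982) Ch. 2 (periodic b.c., lattice symmetries); H.-O. Georgii,
Gibbs Measures and Phase Transitions (2011) §5.1 (translations).
-/

set_option autoImplicit false

noncomputable section

open scoped SchwartzMap BigOperators ENNReal
open MeasureTheory Filter Topology
open Literature.MathematicalPhysics.QuantumFieldTheory Literature.MathematicalPhysics.QuantumLattice
open Literature.MathematicalPhysics.AQFT
open Literature.Probability.LatticeModels (Site)
open Summit.QuantumFields.YangMills.Theorems.ROT (PeriodCell)

namespace Summit.QuantumFields.YangMills.Theorems.RecentredCoverTransfer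

/-! ## §1 The cell translation: reduction, holonomies, the Wilson action, the product Haar measure, Wilson's measure -/

section CellMap

variable {d : ℕ} (C : PeriodCell d)

/-- Reduction to the transversal commutes with translation, up to `P`: `toRep (red y + v) = toRep (y + v)`. [folklore] -/
theorem toRep_red_add (y v : Site d) : C.toRep (C.red y + v) = C.toRep (y + v) := by
  rw [PeriodCell.toRep_eq_toRep_iff, add_sub_add_right_eq_sub]
  exact C.red_sub_mem y

/-- The same with the representative coerced back to `ℤᵈ`. [folklore] -/
theorem toRep_coe_toRep_add (y v : Site d) : C.toRep ((C.toRep y : Site d) + v) = C.toRep (y + v) :=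
  toRep_red_add C y v

/-- Translation maps neighbours to neighbours on the cell: `toRep ((x + eᵢ)~ + v) = (toRep (x + v) + eᵢ)~`. [folklore] -/
theorem toRep_shift_add (x : C.TSite) (i : Fin d) (v : Site d) :
    C.toRep ((C.shift x i : Site d) + v) = C.shift (C.toRep ((x : Site d) + v)) i := by
  simp only [PeriodCell.shift, PeriodCell.coe_toRep]
  rw [toRep_red_add, toRep_red_add, add_right_comm]

/-- The site bijection `x ↦ toRep (x + v)` of the cell induced by the translation by `v`. [folklore] -/
theorem exists_tsiteTranslate (v : Site d) :
    ∃ e : C.TSite ≃ C.TSite, ∀ x, e x = C.toRep ((x : Site d) + v) :=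
  ⟨{ toFun := fun x => C.toRep ((x : Site d) + v)
     invFun := fun x => C.toRep ((x : Site d) + -v)
     left_inv := fun x => by
       simp only
       rw [toRep_coe_toRep_add, add_neg_cancel_right, PeriodCell.toRep_coe]
     right_inv := fun x => by
       simp only
       rw [toRep_coe_toRep_add, neg_add_cancel_right, PeriodCell.toRep_coe] },
    fun _ => rfl⟩

variable {G : Type*} [Group G]

/-- **The cell translation intertwines the plaquette holonomies**: the holonomy of the translated configuration around `(x; i, j)`
is the holonomy of the original one around `(toRep (x + v); i, j)`. [folklore] -/
theorem holonomy_cellTranslate (v : Site d) (U : C.Config G) (x : C.TSite) (i j : Fin d) :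
    C.holonomy (fun e : C.TEdge => U (C.toRep ((e.1 : Site d) + v), e.2)) x i j =
      C.holonomy U (C.toRep ((x : Site d) + v)) i j := by
  simp only [PeriodCell.holonomy, toRep_shift_add]

variable {N : ℕ} (ρ : G →* Matrix (Fin N) (Fin N) ℂ)

/-- **The Wilson action of the cell is translation invariant** (the plaquettes are permuted). [folklore] -/
theorem action_cellTranslate (v : Site d) (U : C.Config G) :
    C.action ρ (fun e : C.TEdge => U (C.toRep ((e.1 : Site d) + v), e.2)) = C.action ρ U := by
  unfold PeriodCell.action
  simp only [holonomy_cellTranslate C v U]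
  obtain ⟨e, he⟩ := exists_tsiteTranslate C v
  refine Fintype.sum_equiv (e.prodCongr (Equiv.refl _)) _ _ fun p => ?_
  obtain ⟨x, q⟩ := p
  show _ = (N : ℝ) - (ρ (C.holonomy U (e x) q.1.1 q.1.2)).trace.re
  rw [he]

variable [TopologicalSpace G] [IsTopologicalGroup G] [CompactSpace G] [MeasurableSpace G] [BorelSpace G]

/-- **The cell translation is a measurable automorphism preserving the product Haar measure** (it is
`MeasurableEquiv.arrowCongr'` of the edge bijection `(x, i) ↦ (toRep (x − v), i)`). [folklore] -/
theorem exists_measurableEquiv_cellTranslate (v : Site d) :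
    ∃ Φ : C.Config G ≃ᵐ C.Config G,
      (∀ U : C.Config G, Φ U = fun e : C.TEdge => U (C.toRep ((e.1 : Site d) + v), e.2)) ∧
      MeasurePreserving Φ (Measure.pi fun _ : C.TEdge => haarProbability G)
        (Measure.pi fun _ : C.TEdge => haarProbability G) := by
  let ε : C.TEdge ≃ C.TEdge :=
    { toFun := fun e => (C.toRep ((e.1 : Site d) + -v), e.2)
      invFun := fun e => (C.toRep ((e.1 : Site d) + v), e.2)
      left_inv := fun e => by
        refine Prod.ext ?_ rfl
        simp only
        rw [toRep_coe_toRep_add, neg_add_cancel_right, PeriodCell.toRep_coe]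
      right_inv := fun e => by
        refine Prod.ext ?_ rfl
        simp only
        rw [toRep_coe_toRep_add, add_neg_cancel_right, PeriodCell.toRep_coe] }
  refine ⟨MeasurableEquiv.arrowCongr' ε (MeasurableEquiv.refl G), fun U => rfl, ?_⟩
  exact measurePreserving_arrowCongr' (fun _ : C.TEdge => haarProbability G) (fun _ : C.TEdge => haarProbability G) ε
    (MeasurableEquiv.refl G) fun _ => MeasurePreserving.id _

/-- **Change of variables in Wilson's measure of the cell**: `∫ g(U(· + v)) dμ_C(U) = ∫ g(U) dμ_C(U)` for every integrand `g`
(the cell translation preserves the product Haar measure and the Wilson density). [folklore] -/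
theorem integral_comp_cellTranslate (β : ℝ) (v : Site d) (g : C.Config G → ℝ) :
    ∫ U, g (fun e : C.TEdge => U (C.toRep ((e.1 : Site d) + v), e.2)) ∂(C.measure ρ β) =
      ∫ U, g U ∂(C.measure ρ β) := by
  obtain ⟨Φ, hΦ, hpi⟩ := exists_measurableEquiv_cellTranslate C (G := G) v
  have hmp : MeasurePreserving Φ (C.measure (G := G) ρ β) (C.measure (G := G) ρ β) := by
    refine ⟨Φ.measurable, ?_⟩
    simp only [PeriodCell.measure, Measure.map_smul, PeriodCell.weight]
    rw [withDensity_map_of_measurableEquiv _ _ _ hpi.map_eq]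
    intro U
    simp only [hΦ U, action_cellTranslate C ρ v]
  have h := hmp.integral_comp' g
  simp only [hΦ] at h
  exact h

end CellMap

/-! ## §2 The periodic lift, the lattice translations, the mean and the centred moments -/

section Lift

variable {d : ℕ} (C : PeriodCell d) {G : Type*}

section

variable [MeasurableSpace G]

/-- **The cell translation lifts to the lattice translation**: `lift (U(· + v)) = configShift (−v) (lift U)`. [folklore] -/
theorem lift_cellTranslate (v : Site d) (U : C.Config G) :
    C.lift (fun e : C.TEdge => U (C.toRep ((e.1 : Site d) + v), e.2)) = configShift (-v) (C.lift U) := by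
  funext e
  simp only [PeriodCell.lift_apply, configShift_apply, PeriodCell.coe_toRep, sub_neg_eq_add]
  rw [toRep_red_add]

end

variable [Group G] {N : ℕ} (ρ : G →* Matrix (Fin N) (Fin N) ℂ)
  [TopologicalSpace G] [IsTopologicalGroup G] [CompactSpace G] [MeasurableSpace G] [BorelSpace G]

/-- **Translation invariance of the cell state read through the lift**: `∫ g(τ_{−v} Ũ) dμ_C = ∫ g(Ũ) dμ_C`. [folklore] -/
theorem integral_comp_configShift_neg_lift (β : ℝ) (v : Site d) (g : LGConfig d G → ℝ) :
    ∫ U, g (configShift (-v) (C.lift U)) ∂(C.measure ρ β) = ∫ U, g (C.lift U) ∂(C.measure ρ β) := by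
  have h := integral_comp_cellTranslate C ρ β v (fun U => g (C.lift U))
  simp only [lift_cellTranslate] at h
  exact h

/-- The same for `τ_v`: `∫ g(τ_v Ũ) dμ_C = ∫ g(Ũ) dμ_C`. [folklore] -/
theorem integral_comp_configShift_lift (β : ℝ) (v : Site d) (g : LGConfig d G → ℝ) :
    ∫ U, g (configShift v (C.lift U)) ∂(C.measure ρ β) = ∫ U, g (C.lift U) ∂(C.measure ρ β) := by
  have h := integral_comp_configShift_neg_lift C ρ β (-v) g
  rwa [neg_neg] at h

/-- ★ **The one-point function of the cell is constant**: `∫ O(τ_{−x} Ũ) dμ_C(U) = C.mean O` for every site `x`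
(`E_C[O(τ_x U)] = m_C`). [folklore] -/
theorem integral_obs_shift_lift_eq_mean (β : ℝ) (O : LGConfig d G → ℝ) (x : Site d) :
    ∫ U, O (configShift (-x) (C.lift U)) ∂(C.measure ρ β) = C.mean ρ β O :=
  integral_comp_configShift_neg_lift C ρ β x O

/-- ★ **The cell mean is translation invariant**: `C.mean (O ∘ τ_v) = C.mean O`. [folklore] -/
theorem mean_comp_configShift (β : ℝ) (O : LGConfig d G → ℝ) (v : Site d) :
    C.mean ρ β (fun V => O (configShift v V)) = C.mean ρ β O :=
  integral_comp_configShift_lift C ρ β v O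

/-- ★ **The centred cell moments are invariant under simultaneous translation of the sites**:
`W_C(x₁ + v, …, xₙ + v) = W_C(x₁, …, xₙ)`. [folklore] -/
theorem moment_translate (β : ℝ) (O : LGConfig d G → ℝ) (m : ℝ) {n : ℕ} (x : Fin n → Site d) (v : Site d) :
    C.moment ρ β O m (fun i => x i + v) = C.moment ρ β O m x := by
  unfold PeriodCell.moment
  -- `τ_{−(xᵢ+v)} = τ_{−xᵢ} ∘ τ_{−v}` (composition of lattice translations, `CurvatureKernel.LatticeWindow.configShift_configShift`)
  have hcomp : ∀ (V : LGConfig d G) (i : Fin n),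
      configShift (-(x i + v)) V = configShift (-(x i)) (configShift (-v) V) := fun V i => by
    funext e
    simp only [configShift_apply, sub_sub, neg_add]
  simp_rw [hcomp]
  exact integral_comp_configShift_neg_lift C ρ β v (fun V => ∏ i, (O (configShift (-(x i)) V) - m))

end Lift

/-! ## §3 ★ The recentring identities -/

section Recentring

variable {d : ℕ} (C : PeriodCell d) {G : Type*} [Group G] {N : ℕ} (ρ : G →* Matrix (Fin N) (Fin N) ℂ)
  [TopologicalSpace G] [IsTopologicalGroup G] [CompactSpace G] [MeasurableSpace G] [BorelSpace G]

omit [Group G] [TopologicalSpace G] [IsTopologicalGroup G] [CompactSpace G] [BorelSpace G] in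
/-- The periodic lift of a skew-torus configuration is measurable. [folklore] -/
theorem measurable_cellLift : Measurable (C.lift (G := G)) :=
  measurable_pi_lambda _ fun _ => measurable_pi_apply _

/-- A bounded measurable observable, translated and read through the lift, is integrable for Wilson's (probability) law on the
cell. [folklore] -/
theorem integrable_obs_shift_lift (hρ : Continuous ρ) (β : ℝ) {O : LGConfig d G → ℝ} (hO : Measurable O) {B : ℝ}
    (hB : ∀ V, |O V| ≤ B) (x : Site d) :
    Integrable (fun U : C.Config G => O (configShift (-x) (C.lift U))) (C.measure ρ β) := by
  haveI := C.isProbabilityMeasure_measure ρ hρ β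
  refine Integrable.of_bound
    (hO.comp ((configShift _).measurable.comp (measurable_cellLift C))).aestronglyMeasurable B ?_
  exact Eventually.of_forall fun U => by rw [Real.norm_eq_abs]; exact hB _

/-- The product of two translated copies of a bounded measurable observable is integrable on the cell. [folklore] -/
theorem integrable_obs_shift_lift_mul (hρ : Continuous ρ) (β : ℝ) {O : LGConfig d G → ℝ} (hO : Measurable O) {B : ℝ}
    (hB : ∀ V, |O V| ≤ B) (x y : Site d) :
    Integrable (fun U : C.Config G => O (configShift (-x) (C.lift U)) * O (configShift (-y) (C.lift U))) (C.measure ρ β) := by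
  haveI := C.isProbabilityMeasure_measure ρ hρ β
  have hm : ∀ z : Site d, Measurable fun U : C.Config G => O (configShift (-z) (C.lift U)) := fun z =>
    hO.comp ((configShift _).measurable.comp (measurable_cellLift C))
  refine Integrable.of_bound ((hm x).mul (hm y)).aestronglyMeasurable (B * B) ?_
  refine Eventually.of_forall fun U => ?_
  rw [norm_mul, Real.norm_eq_abs, Real.norm_eq_abs]
  have h1 := hB (configShift (-x) (C.lift U))
  have h2 := hB (configShift (-y) (C.lift U))
  exact mul_le_mul h1 h2 (abs_nonneg _) ((abs_nonneg _).trans h1)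

/-- ★ **`n = 1`**: the one-point moment with additive normalisation `m` is the constant `C.mean O − m` (it vanishes at the
canonical centring `m = C.mean O`). [folklore] -/
theorem moment_one_eq (hρ : Continuous ρ) (β : ℝ) {O : LGConfig d G → ℝ} (hO : Measurable O) {B : ℝ}
    (hB : ∀ V, |O V| ≤ B) (m : ℝ) (x : Fin 1 → Site d) :
    C.moment ρ β O m x = C.mean ρ β O - m := by
  haveI := C.isProbabilityMeasure_measure ρ hρ β
  unfold PeriodCell.moment
  simp only [Finset.univ_unique, Fin.default_eq_zero, Finset.prod_singleton]
  rw [integral_sub (integrable_obs_shift_lift C ρ hρ β hO hB (x 0)) (integrable_const _), integral_const,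
    integral_obs_shift_lift_eq_mean]
  simp

/-- ★ **`n = 2` RECENTRING**: `W_m(x, y) = W_μ(x, y) + (μ − m)²` with `μ = C.mean O` the cell mean — expand
`(A − m)(B − m) = (A − μ)(B − μ) + (μ − m)(A − μ) + (μ − m)(B − μ) + (μ − m)²` and use `E_C A = E_C B = μ` (§2). [folklore] -/
theorem moment_two_recentre (hρ : Continuous ρ) (β : ℝ) {O : LGConfig d G → ℝ} (hO : Measurable O) {B : ℝ}
    (hB : ∀ V, |O V| ≤ B) (m : ℝ) (x : Fin 2 → Site d) :
    C.moment ρ β O m x = C.moment ρ β O (C.mean ρ β O) x + (C.mean ρ β O - m) ^ 2 := by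
  haveI := C.isProbabilityMeasure_measure ρ hρ β
  set μ := C.mean ρ β O with hμ
  unfold PeriodCell.moment
  simp only [Fin.prod_univ_two]
  set A := fun U : C.Config G => O (configShift (-(x 0)) (C.lift U)) with hA
  set Bf := fun U : C.Config G => O (configShift (-(x 1)) (C.lift U)) with hBf
  have hiA : Integrable A (C.measure ρ β) := integrable_obs_shift_lift C ρ hρ β hO hB (x 0)
  have hiB : Integrable Bf (C.measure ρ β) := integrable_obs_shift_lift C ρ hρ β hO hB (x 1)
  have hiAB : Integrable (fun U => (A U - μ) * (Bf U - μ)) (C.measure ρ β) := by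
    have h := (integrable_obs_shift_lift_mul C ρ hρ β hO hB (x 0) (x 1)).sub
      (((hiB.const_mul μ).add (hiA.const_mul μ)).sub (integrable_const (μ * μ)))
    refine h.congr (Eventually.of_forall fun U => ?_)
    simp only [hA, hBf, Pi.sub_apply, Pi.add_apply]
    ring
  have hEA : ∫ U, A U ∂(C.measure ρ β) = μ := integral_obs_shift_lift_eq_mean C ρ β O (x 0)
  have hEB : ∫ U, Bf U ∂(C.measure ρ β) = μ := integral_obs_shift_lift_eq_mean C ρ β O (x 1)
  have hpt : (fun U : C.Config G => (A U - m) * (Bf U - m)) =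
      fun U => (A U - μ) * (Bf U - μ) + ((μ - m) * A U + ((μ - m) * Bf U + (-(2 * (μ - m) * μ) + (μ - m) ^ 2))) := by
    funext U; ring
  have hi3 : Integrable (fun U => (μ - m) * Bf U + (-(2 * (μ - m) * μ) + (μ - m) ^ 2)) (C.measure ρ β) :=
    (hiB.const_mul _).add (integrable_const _)
  have hi2 : Integrable (fun U => (μ - m) * A U + ((μ - m) * Bf U + (-(2 * (μ - m) * μ) + (μ - m) ^ 2))) (C.measure ρ β) :=
    (hiA.const_mul _).add hi3
  rw [show (fun U : C.Config G => (O (configShift (-(x 0)) (C.lift U)) - m) * (O (configShift (-(x 1)) (C.lift U)) - m)) =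
      fun U => (A U - m) * (Bf U - m) from rfl, hpt, integral_add hiAB hi2, integral_add (hiA.const_mul _) hi3,
    integral_add (hiB.const_mul _) (integrable_const _), integral_const_mul, integral_const_mul, integral_const, hEA, hEB]
  simp only [probReal_univ, smul_eq_mul, one_mul]
  ring

/-- ★ **The `n = 2` identity on test functions**: for every site embedding `A` and test function `F`,
`dist_C(A; m) F = dist_C(A; μ) F + (μ − m)²·Σ_{x ∈ reps²} F(A x)` (`μ = C.mean O`).  With `O` the curvature species, `m = m_T`
the torus mean and `A = a_k·`, the `n = 2` clause of `CoverRecentring` reads `(m_C − m_T)²·Σ_{x,y} F(a_k x, a_k y) → 0`. [folklore] -/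
theorem dist_two_recentre (hρ : Continuous ρ) (β : ℝ) (A : Site d → EuclideanSpace ℝ (Fin d)) {O : LGConfig d G → ℝ}
    (hO : Measurable O) {B : ℝ} (hB : ∀ V, |O V| ≤ B) (m : ℝ) (F : 𝓢((Fin 2 → EuclideanSpace ℝ (Fin d)), ℂ)) :
    C.dist ρ β A O m 2 F =
      C.dist ρ β A O (C.mean ρ β O) 2 F +
        (((C.mean ρ β O - m) ^ 2 : ℝ) : ℂ) * ∑ x ∈ Fintype.piFinset (fun _ : Fin 2 => C.reps), F (fun i => A (x i)) := by
  rw [PeriodCell.dist_apply, PeriodCell.dist_apply, Finset.mul_sum, ← Finset.sum_add_distrib]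
  refine Finset.sum_congr rfl fun x _ => ?_
  rw [moment_two_recentre C ρ hρ β hO hB m x, Complex.ofReal_add, add_mul]

/-- The `n = 2` identity as a DIFFERENCE: `dist_C(A; μ) F − dist_C(A; m) F = −(μ − m)²·Σ_{x ∈ reps²} F(A x)`. [folklore] -/
theorem dist_two_sub_dist_two (hρ : Continuous ρ) (β : ℝ) (A : Site d → EuclideanSpace ℝ (Fin d)) {O : LGConfig d G → ℝ}
    (hO : Measurable O) {B : ℝ} (hB : ∀ V, |O V| ≤ B) (m : ℝ) (F : 𝓢((Fin 2 → EuclideanSpace ℝ (Fin d)), ℂ)) :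
    C.dist ρ β A O (C.mean ρ β O) 2 F - C.dist ρ β A O m 2 F =
      -((((C.mean ρ β O - m) ^ 2 : ℝ) : ℂ) * ∑ x ∈ Fintype.piFinset (fun _ : Fin 2 => C.reps), F (fun i => A (x i))) := by
  rw [dist_two_recentre C ρ hρ β A hO hB m F]
  ring

end Recentring

end Summit.QuantumFields.YangMills.Theorems.RecentredCoverTransfer

end
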